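import Literature.AnabelianGeometry.EtaleTheta.Discharge.Sec4RootDivisors
import Literature.AnabelianGeometry.EtaleTheta.Discharge.Sec4BiKummerRoots
import Literature.AnabelianGeometry.EtaleTheta.Discharge.Sec3Thm37Holds
import Literature.AnabelianGeometry.EtaleTheta.Discharge.Sec3Thm37SubQFT

/-!
# [EtTh] Proposition 4.3 (i) — EXISTENCE of the bi-Kummer `N`-th root and `H_⊙`-ampleness of `B_N`,
# discharged over the model Frobenioid modulo the printed base-level inputs

Mochizuki, *The étale theta function …*, Publ. RIMS **45** (2009), Prop. 4.3 (i) p.90, proof p.91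
[cite: MochizukiEtTh2009, Prop 4.3 (i) p.90–91]: "there exist UNIQUE `s'_N{}^{gp}`, `s''_N{}^{gp}` …
[In particular, `B_N` is `H_⊙`-ample.] … to show that such an `s_N^triv|_{H_{A_N}}(h)` "descends" …
it suffices [by the general theory of Frobenioids — the first equivalence of categories involving
pre-steps of [FrdI] Def. 1.3 (iii)(d); total epimorphicity] to prove that `Div(s'_N)`, `Div(s''_N)` are
fixed by `H_{A_N}`.  But since `N · Div(s'_N)`, `N · Div(s''_N)` arise as pull-backs to `A_N` of
elements of `Φ(A_⊙)`, this follows from the fact that `H_⊙` acts trivially on `A_⊙^bs` [+ `Φ(A_N)`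
torsion-free]."

abc-iut cell, layer L2 (seat abc-iut-L6-t12), over abc-iut-L2-t3's `BiKummerRoots.lean` v4 (`Prop43_i`
with the pins `hstriv`, `hident` and domain `≅ A_⊙`) and my landed ingredients (`Sec4RootDivisors`:
`N·Div(s'_N) = α^*Div(s')`, torsion-freeness, unique lifting along pre-steps; `Sec4BiKummerRoots`:
uniqueness `sNum_sDen_unique`).  The two inputs the abstract setting cannot supply — they concern the
surjections `Π^tp_X ↠ Aut_D(−)` of the Galois objects, which `BiKummerSetting` carries without
naturality (note G2 of 2026-08-25T22:55Z; merge-gated on the temperoid structure) — enter as the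
printed BASE-LEVEL hypotheses:
* `hα` — "`H_⊙` acts trivially on `A_⊙^bs`" in the form the proof uses it: the trivializing section acts
  OVER `A^bs` trivially THROUGH `α`: `Base(s_N^triv(h)) ∘ Base(α)… = Base(α)`, i.e.
  `baseMap (s^triv h) ≫ baseMap α = baseMap α` for all `h ∈ H_{A_N}`;
* `hamp` — every element of `H_{B_N}^bs` is the transport along the base-isomorphism `Base(s'_N)` of (the
  base of) an element of `H_{A_N}` (`Π^tp_X`-naturality of `Base(s'_N)` + `A_N` ample), used only for
  "[In particular, `B_N` is `H_⊙`-ample]".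
Results: `NthRoot.exists_biKummerRoot` (existence of `(s'^{gp}_N, s''^{gp}_N)` as a `BiKummerRoot` with
prescribed `s^triv`, `ident`), `NthRoot.existsUnique_sections` (the `∃!` clause of `Prop43_i`),
`BiKummerRoot.isAmple_BN`, and the assembly `prop43_i_of : … → S.Prop43_i pullFrac`
(`Φ` divisorial, `B` group-like).  Theorems only.
-/

noncomputable section

namespace Literature.AnabelianGeometry.EtaleTheta

open CategoryTheory Opposite Literature.AlgebraicGeometry.Frobenioids

universe u₀ v₀ u v w

variable {K : Type u₀} [Field K]

namespace BiKummerSetting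

variable {X : SemiGraphs.TemperedArithmeticGroup.{u₀} K} {D₀ : Type u₀} [Category.{v₀} D₀]
  {V : FrdIMonoidStub.{w}} {T : RealifiedDivisorMonoids (D₀ := D₀) V} {D : Type u} [Category.{v} D]
  {VD : FrdICatStub.{u, v, w} D} {S : BiKummerSetting X T D VD}

namespace NthRoot

variable {A B : S.C} {f : S.biratUnits A} {P : S.FractionPair f B} {N : ℕ+}
  {pullFrac : ∀ {A A' : S.C} (_ : A' ⟶ A), S.biratUnits A → S.biratUnits A'}
  (R : S.NthRoot f P N pullFrac)

/-- If `τ ∈ Aut_C(A_N)` acts over `A^bs` trivially through `α` (`Base(τ)·Base(α) = Base(α)`), then `τ`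
fixes `Div(s'_N)` ("`N · Div(s'_N)` arise[s] as pull-back … of `Div(s')` … `H_⊙` acts trivially on
`A_⊙^bs` … `Φ(A_N)` torsion-free", p.91). [cite: MochizukiEtTh2009, Prop 4.3 (i) p.91] -/
theorem pull_div_num_eq_of_base (hΦd : Objectwise (fun M _ => IsDivisorial M) S.tf.divisorMonoid) (τ : Aut R.AN)
    (hτ : ModelFrobenioid.baseMap τ.hom ≫ ModelFrobenioid.baseMap R.α = ModelFrobenioid.baseMap R.α) :
    pull S.tf.divisorMonoid (ModelFrobenioid.baseMap τ.hom) (ModelFrobenioid.div R.pair.num) =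
      ModelFrobenioid.div R.pair.num := by
  apply R.pull_div_num_eq hΦd τ
  rw [← pull_comp, hτ]

/-- The same for `Div(s''_N)`. [cite: MochizukiEtTh2009, Prop 4.3 (i) p.91] -/
theorem pull_div_den_eq_of_base (hΦd : Objectwise (fun M _ => IsDivisorial M) S.tf.divisorMonoid) (τ : Aut R.AN)
    (hτ : ModelFrobenioid.baseMap τ.hom ≫ ModelFrobenioid.baseMap R.α = ModelFrobenioid.baseMap R.α) :
    pull S.tf.divisorMonoid (ModelFrobenioid.baseMap τ.hom) (ModelFrobenioid.div R.pair.den) =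
      ModelFrobenioid.div R.pair.den := by
  apply R.pull_div_den_eq hΦd τ
  rw [← pull_comp, hτ]

/-- **Prop. 4.3 (i), EXISTENCE** (p.90–91): given a trivializing section `s_N^triv` over `H_{A_N}` and an
identification `H_{A_N} ≅ H_{B_N}` lying over `Base(s'_N)`, if `H_{A_N}` acts over `A^bs` trivially through
`α` then the pair `(s'_N{}^{gp}, s''_N{}^{gp})` EXISTS: there is a bi-Kummer `N`-th root with these
`s^triv`, `ident` — each `s_N^triv(h)` descends uniquely along the pre-steps `s'_N`, `s''_N`, and the
descents are homomorphisms by uniqueness. [cite: MochizukiEtTh2009, Prop 4.3 (i) p.90] -/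
theorem exists_biKummerRoot (hΦd : Objectwise (fun M _ => IsDivisorial M) S.tf.divisorMonoid)
    (hBg : Objectwise (fun M _ => IsGroupLike M) S.tf.ratFnFunctor) (hA : S.IsGalois R.AN) (hB : S.IsGalois R.BN)
    (striv : S.HA R.AN hA →* Aut R.AN)
    (hstriv : ∀ h : S.HA R.AN hA, S.autBase R.AN (striv h) = S.autBase R.AN (h : Aut R.AN))
    (ident : S.HA R.AN hA ≃* S.HA R.BN hB)
    (hident : ∀ h : S.HA R.AN hA,
      S.base.map R.pair.num ≫ S.base.map (ident h : Aut R.BN).hom =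
        S.base.map (h : Aut R.AN).hom ≫ S.base.map R.pair.num)
    (hα : ∀ h : S.HA R.AN hA,
      ModelFrobenioid.baseMap (striv h).hom ≫ ModelFrobenioid.baseMap R.α = ModelFrobenioid.baseMap R.α) :
    ∃ K : S.BiKummerRoot R hA hB, K.striv = striv ∧ K.ident = ident := by
  -- the unique descents along `s'_N` and `s''_N`
  have hexN : ∀ h : S.HA R.BN hB, ∃! σ : Aut R.BN,
      R.pair.num ≫ σ.hom = (striv (ident.symm h)).hom ≫ R.pair.num := fun h =>
    R.existsUnique_aut_comp_num hΦd hBg _ (R.pull_div_num_eq_of_base hΦd _ (hα _))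
  have hexD : ∀ h : S.HA R.BN hB, ∃! σ : Aut R.BN,
      R.pair.den ≫ σ.hom = (striv (ident.symm h)).hom ≫ R.pair.den := fun h =>
    R.existsUnique_aut_comp_den hΦd hBg _ (R.pull_div_den_eq_of_base hΦd _ (hα _))
  choose σN hσN using fun h => (hexN h).exists
  choose σD hσD using fun h => (hexD h).exists
  -- they are homomorphisms (uniqueness of the descent)
  have hN1 : σN 1 = 1 := by
    refine ((hexN 1).unique (hσN 1) ?_).symm ▸ rfl
    rw [map_one, map_one]
    change R.pair.num ≫ 𝟙 _ = 𝟙 _ ≫ R.pair.num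
    rw [Category.comp_id, Category.id_comp]
  have hD1 : σD 1 = 1 := by
    refine ((hexD 1).unique (hσD 1) ?_).symm ▸ rfl
    rw [map_one, map_one]
    change R.pair.den ≫ 𝟙 _ = 𝟙 _ ≫ R.pair.den
    rw [Category.comp_id, Category.id_comp]
  have hNmul : ∀ a b, σN (a * b) = σN a * σN b := by
    intro a b
    refine (hexN (a * b)).unique (hσN (a * b)) ?_
    rw [map_mul, map_mul]
    change R.pair.num ≫ ((σN b).hom ≫ (σN a).hom) =
      ((striv (ident.symm b)).hom ≫ (striv (ident.symm a)).hom) ≫ R.pair.num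
    rw [← Category.assoc, hσN b, Category.assoc, hσN a, Category.assoc]
  have hDmul : ∀ a b, σD (a * b) = σD a * σD b := by
    intro a b
    refine (hexD (a * b)).unique (hσD (a * b)) ?_
    rw [map_mul, map_mul]
    change R.pair.den ≫ ((σD b).hom ≫ (σD a).hom) =
      ((striv (ident.symm b)).hom ≫ (striv (ident.symm a)).hom) ≫ R.pair.den
    rw [← Category.assoc, hσD b, Category.assoc, hσD a, Category.assoc]
  let sNum : S.HA R.BN hB →* Aut R.BN :=
    { toFun := σN, map_one' := hN1, map_mul' := hNmul }
  let sDen : S.HA R.BN hB →* Aut R.BN :=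
    { toFun := σD, map_one' := hD1, map_mul' := hDmul }
  refine ⟨{ striv := striv, autBase_striv := hstriv, ident := ident, autBase_ident := hident,
            sNum := sNum, sDen := sDen, comm_num := fun h => ?_, comm_den := fun h => ?_ }, rfl, rfl⟩
  · have e := hσN (ident h)
    rw [MulEquiv.symm_apply_apply] at e
    exact e
  · have e := hσD (ident h)
    rw [MulEquiv.symm_apply_apply] at e
    exact e

/-- **Prop. 4.3 (i), the `∃!` clause**: existence (above) together with uniqueness
(`BiKummerRoot.sNum_sDen_unique`: two bi-Kummer roots with the same `s^triv` and `ident` have the same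
sections). [cite: MochizukiEtTh2009, Prop 4.3 (i) p.90] -/
theorem existsUnique_sections (hΦd : Objectwise (fun M _ => IsDivisorial M) S.tf.divisorMonoid)
    (hBg : Objectwise (fun M _ => IsGroupLike M) S.tf.ratFnFunctor) (hA : S.IsGalois R.AN) (hB : S.IsGalois R.BN)
    (striv : S.HA R.AN hA →* Aut R.AN)
    (hstriv : ∀ h : S.HA R.AN hA, S.autBase R.AN (striv h) = S.autBase R.AN (h : Aut R.AN))
    (ident : S.HA R.AN hA ≃* S.HA R.BN hB)
    (hident : ∀ h : S.HA R.AN hA,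
      S.base.map R.pair.num ≫ S.base.map (ident h : Aut R.BN).hom =
        S.base.map (h : Aut R.AN).hom ≫ S.base.map R.pair.num)
    (hα : ∀ h : S.HA R.AN hA,
      ModelFrobenioid.baseMap (striv h).hom ≫ ModelFrobenioid.baseMap R.α = ModelFrobenioid.baseMap R.α) :
    ∃! p : (S.HA R.BN hB →* Aut R.BN) × (S.HA R.BN hB →* Aut R.BN),
      ∃ K : S.BiKummerRoot R hA hB, K.striv = striv ∧ K.ident = ident ∧ K.sNum = p.1 ∧ K.sDen = p.2 := by
  obtain ⟨K, hKs, hKi⟩ := R.exists_biKummerRoot hΦd hBg hA hB striv hstriv ident hident hα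
  refine ⟨(K.sNum, K.sDen), ⟨K, hKs, hKi, rfl, rfl⟩, ?_⟩
  rintro ⟨p₁, p₂⟩ ⟨K', hK's, hK'i, rfl, rfl⟩
  obtain ⟨h1, h2⟩ := K.sNum_sDen_unique hΦd hBg K' (hK's.trans hKs.symm) (hK'i.trans hKi.symm)
  exact Prod.ext h1 h2

end NthRoot

namespace BiKummerRoot

variable {A B : S.C} {f : S.biratUnits A} {P : S.FractionPair f B} {N : ℕ+}
  {pullFrac : ∀ {A A' : S.C} (_ : A' ⟶ A), S.biratUnits A → S.biratUnits A'}
  {R : S.NthRoot f P N pullFrac} {hA : S.IsGalois R.AN} {hB : S.IsGalois R.BN}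

/-- `Base(s'^{gp}_N(ident h)) ∘ Base(s'_N) = Base(s'_N) ∘ Base(h)`: the section `s'^{gp}_N` lies over the
transport of `H_{A_N}^bs` along `Base(s'_N)`. [cite: MochizukiEtTh2009, Prop 4.3 (i) p.90] -/
theorem baseMap_num_comp_baseMap_sNum (K : S.BiKummerRoot R hA hB) (h : S.HA R.AN hA) :
    ModelFrobenioid.baseMap R.pair.num ≫ ModelFrobenioid.baseMap (K.sNum (K.ident h)).hom =
      (S.autBase R.AN (h : Aut R.AN)).hom ≫ ModelFrobenioid.baseMap R.pair.num := by
  have e := congrArg ModelFrobenioid.baseMap (K.comm_num h)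
  rw [ModelFrobenioid.baseMap_comp, ModelFrobenioid.baseMap_comp] at e
  rw [e, ← K.autBase_striv h]
  rfl

/-- **"[In particular, `B_N` is `H_⊙`-ample.]"** (Prop. 4.3 (i), p.90): if every element of `H_{B_N}^bs`
is the transport along `Base(s'_N)` of the base of an element of `H_{A_N}` (naturality of
`Π^tp_X ↠ Aut_D(−)` along `Base(s'_N)` + `A_N` ample), then it lifts to `Aut_C(B_N)` — namely to
`s'^{gp}_N` of the corresponding element. [cite: MochizukiEtTh2009, Prop 4.3 (i) p.90] -/
theorem isAmple_BN (K : S.BiKummerRoot R hA hB)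
    (hamp : ∀ g ∈ S.HAbs R.BN hB, ∃ h : S.HA R.AN hA,
      ModelFrobenioid.baseMap R.pair.num ≫ g.hom =
        (S.autBase R.AN (h : Aut R.AN)).hom ≫ ModelFrobenioid.baseMap R.pair.num) :
    S.IsAmple R.BN := by
  haveI : IsIso (ModelFrobenioid.baseMap R.pair.num) := R.pair.isPreStep_num.2
  refine ⟨hB, fun g hg => ?_⟩
  obtain ⟨h, hh⟩ := hamp g hg
  refine ⟨K.sNum (K.ident h), Iso.ext ?_⟩
  apply (cancel_epi (ModelFrobenioid.baseMap R.pair.num)).mp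
  rw [hh, ← K.baseMap_num_comp_baseMap_sNum h]
  rfl

end BiKummerRoot

/-- **[EtTh] Proposition 4.3 (i) DISCHARGED over the model Frobenioid modulo the printed base-level
inputs**: abc-iut-L2-t3's named `Prop43_i` (v4) follows from `Φ` divisorial, `B` group-like, and — for
every `N`-th root of a fraction-pair with domain `≅ A_⊙` and every trivializing section — (`hα`) the
section acts over `A^bs` trivially through `α` ("`H_⊙` acts trivially on `A_⊙^bs`") and (`hamp`) every
element of `H_{B_N}^bs` is a transport along `Base(s'_N)` from `H_{A_N}`.
[cite: MochizukiEtTh2009, Prop 4.3 (i) p.90–91] -/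
theorem prop43_i_of (pullFrac : ∀ {A A' : S.C} (_ : A' ⟶ A), S.biratUnits A → S.biratUnits A')
    (hΦd : Objectwise (fun M _ => IsDivisorial M) S.tf.divisorMonoid)
    (hBg : Objectwise (fun M _ => IsGroupLike M) S.tf.ratFnFunctor)
    (hα : ∀ {A B : S.C} {f : S.biratUnits A} {P : S.FractionPair f B} {N : ℕ+}
      (R : S.NthRoot f P N pullFrac) (hA : S.IsGalois R.AN) (striv : S.HA R.AN hA →* Aut R.AN),
      (∀ h : S.HA R.AN hA, S.autBase R.AN (striv h) = S.autBase R.AN (h : Aut R.AN)) →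
      Nonempty (A ≅ S.Aodot) → ∀ h : S.HA R.AN hA,
        ModelFrobenioid.baseMap (striv h).hom ≫ ModelFrobenioid.baseMap R.α = ModelFrobenioid.baseMap R.α)
    (hamp : ∀ {A B : S.C} {f : S.biratUnits A} {P : S.FractionPair f B} {N : ℕ+}
      (R : S.NthRoot f P N pullFrac) (hA : S.IsGalois R.AN) (hB : S.IsGalois R.BN),
      Nonempty (A ≅ S.Aodot) → ∀ g ∈ S.HAbs R.BN hB, ∃ h : S.HA R.AN hA,
        ModelFrobenioid.baseMap R.pair.num ≫ g.hom =
          (S.autBase R.AN (h : Aut R.AN)).hom ≫ ModelFrobenioid.baseMap R.pair.num) :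
    S.Prop43_i pullFrac := by
  intro A B f P N R hA hB striv hstriv ident hident hAo
  refine ⟨R.existsUnique_sections hΦd hBg hA hB striv hstriv ident hident (hα R hA striv hstriv hAo), ?_⟩
  obtain ⟨K, -, -⟩ :=
    R.exists_biKummerRoot hΦd hBg hA hB striv hstriv ident hident (hα R hA striv hstriv hAo)
  exact K.isAmple_BN (hamp R hA hB hAo)

/-! ### "`H_⊙` acts trivially on `A_⊙^bs`" and the reduction of `hα` to the equivariance of `Base(α)` -/

/-- **"`H_⊙` acts trivially on `A_⊙^bs`"** (proof of Prop. 4.3 (i), p.91): the image of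
`H_⊙ = Ker(Π^tp_X ↠ Aut_D(A_⊙^bs))` (Def. 4.1 (ii)) in `Aut_D(A_⊙^bs)` is trivial.
[cite: MochizukiEtTh2009, Def 4.1 (ii) p.87] -/
theorem HAbs_Aodot_eq_bot : S.HAbs S.Aodot S.isGalois_Aodot = ⊥ := by
  rw [eq_bot_iff]
  rintro _ ⟨h, hh, rfl⟩
  exact Subgroup.mem_bot.mpr (MonoidHom.mem_ker.mp hh)

/-- Hence `H_{A_⊙} ⊆ Aut_C(A_⊙)` (the preimage of `H_{A_⊙}^bs`) is the group of base-identity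
automorphisms of `A_⊙`. [cite: MochizukiEtTh2009, Def 4.1 (ii) p.87] -/
theorem HA_Aodot_eq_ker : S.HA S.Aodot S.isGalois_Aodot = (S.autBase S.Aodot).ker := by
  rw [BiKummerSetting.HA, HAbs_Aodot_eq_bot]
  rfl

/-- **The hypothesis `hα` of `prop43_i_of` IS the `Π^tp_X`-equivariance of `Base(α)`** for roots of
fraction-pairs with domain `A_⊙` itself: if every `h ∈ H_{A_N}` lies, through `Base(α) : A_N^bs → A_⊙^bs`,
over SOME element of `H_{A_⊙}^bs` (the equivariance of a morphism of Galois objects for the surjections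
`Π^tp_X ↠ Aut_D(−)` — the temperoid structure the abstract setting does not carry), then, `H_{A_⊙}^bs`
being trivial, every trivializing section acts over `A_⊙^bs` trivially through `α`.
[cite: MochizukiEtTh2009, Prop 4.3 (i) p.91] -/
theorem NthRoot.base_striv_comp_α {B : S.C} {f : S.biratUnits S.Aodot} {P : S.FractionPair f B} {N : ℕ+}
    {pullFrac : ∀ {A A' : S.C} (_ : A' ⟶ A), S.biratUnits A → S.biratUnits A'}
    (R : S.NthRoot f P N pullFrac) (hA : S.IsGalois R.AN) (striv : S.HA R.AN hA →* Aut R.AN)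
    (hstriv : ∀ h : S.HA R.AN hA, S.autBase R.AN (striv h) = S.autBase R.AN (h : Aut R.AN))
    (hequiv : ∀ h : S.HA R.AN hA, ∃ g ∈ S.HAbs S.Aodot S.isGalois_Aodot,
      ModelFrobenioid.baseMap (h : Aut R.AN).hom ≫ ModelFrobenioid.baseMap R.α =
        ModelFrobenioid.baseMap R.α ≫ g.hom)
    (h : S.HA R.AN hA) :
    ModelFrobenioid.baseMap (striv h).hom ≫ ModelFrobenioid.baseMap R.α = ModelFrobenioid.baseMap R.α := by
  obtain ⟨g, hg, e⟩ := hequiv h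
  rw [HAbs_Aodot_eq_bot, Subgroup.mem_bot] at hg
  subst hg
  have hb : ModelFrobenioid.baseMap (striv h).hom = ModelFrobenioid.baseMap (h : Aut R.AN).hom :=
    congrArg Iso.hom (hstriv h)
  rw [hb, e]
  exact Category.comp_id _

/-! ### Dropping the structural hypotheses: `B` group-like always, `Φ` divisorial at the tree vocabulary -/

/-- `prop43_i_of` with `B` group-like DISCHARGED (abc-iut-L2-t3's `ratFnFunctor_isGroupLike_holds`, from
the Def. 3.6 (i) field `isUnit_BΛ`). [cite: MochizukiEtTh2009, Prop 4.3 (i) p.90–91] -/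
theorem prop43_i_of' (pullFrac : ∀ {A A' : S.C} (_ : A' ⟶ A), S.biratUnits A → S.biratUnits A')
    (hΦd : Objectwise (fun M _ => IsDivisorial M) S.tf.divisorMonoid)
    (hα : ∀ {A B : S.C} {f : S.biratUnits A} {P : S.FractionPair f B} {N : ℕ+}
      (R : S.NthRoot f P N pullFrac) (hA : S.IsGalois R.AN) (striv : S.HA R.AN hA →* Aut R.AN),
      (∀ h : S.HA R.AN hA, S.autBase R.AN (striv h) = S.autBase R.AN (h : Aut R.AN)) →
      Nonempty (A ≅ S.Aodot) → ∀ h : S.HA R.AN hA,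
        ModelFrobenioid.baseMap (striv h).hom ≫ ModelFrobenioid.baseMap R.α = ModelFrobenioid.baseMap R.α)
    (hamp : ∀ {A B : S.C} {f : S.biratUnits A} {P : S.FractionPair f B} {N : ℕ+}
      (R : S.NthRoot f P N pullFrac) (hA : S.IsGalois R.AN) (hB : S.IsGalois R.BN),
      Nonempty (A ≅ S.Aodot) → ∀ g ∈ S.HAbs R.BN hB, ∃ h : S.HA R.AN hA,
        ModelFrobenioid.baseMap R.pair.num ≫ g.hom =
          (S.autBase R.AN (h : Aut R.AN)).hom ≫ ModelFrobenioid.baseMap R.pair.num) :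
    S.Prop43_i pullFrac :=
  prop43_i_of pullFrac hΦd S.tf.ratFnFunctor_isGroupLike_holds hα hamp

end BiKummerSetting

/-- **Prop. 4.3 (i) at the tree's vocabulary** (`treeCatVocab`: "divisorial monoid on `D`" = the tree's
notion): BOTH structural hypotheses discharged (`Φ` divisorial by abc-iut-L2-t3's
`isDivisorial_divisorMonoid`, `B` group-like by `ratFnFunctor_isGroupLike_holds`); what remains is exactly
the printed base-level content `hα`, `hamp`. [cite: MochizukiEtTh2009, Prop 4.3 (i) p.90–91] -/
theorem BiKummerSetting.prop43_i_of_tree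
    {X : SemiGraphs.TemperedArithmeticGroup.{u₀} K} {D₀ : Type u₀} [Category.{v₀} D₀]
    {V : FrdIMonoidStub.{w}} {T : RealifiedDivisorMonoids (D₀ := D₀) V} {D : Type u} [Category.{v} D]
    {IsRational IsStrictlyRational : (Dᵒᵖ ⥤ CommMonCat.{w}) → Prop}
    {S : BiKummerSetting X T D (treeCatVocab D IsRational IsStrictlyRational)}
    (pullFrac : ∀ {A A' : S.C} (_ : A' ⟶ A), S.biratUnits A → S.biratUnits A')
    (hα : ∀ {A B : S.C} {f : S.biratUnits A} {P : S.FractionPair f B} {N : ℕ+}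
      (R : S.NthRoot f P N pullFrac) (hA : S.IsGalois R.AN) (striv : S.HA R.AN hA →* Aut R.AN),
      (∀ h : S.HA R.AN hA, S.autBase R.AN (striv h) = S.autBase R.AN (h : Aut R.AN)) →
      Nonempty (A ≅ S.Aodot) → ∀ h : S.HA R.AN hA,
        ModelFrobenioid.baseMap (striv h).hom ≫ ModelFrobenioid.baseMap R.α = ModelFrobenioid.baseMap R.α)
    (hamp : ∀ {A B : S.C} {f : S.biratUnits A} {P : S.FractionPair f B} {N : ℕ+}
      (R : S.NthRoot f P N pullFrac) (hA : S.IsGalois R.AN) (hB : S.IsGalois R.BN),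
      Nonempty (A ≅ S.Aodot) → ∀ g ∈ S.HAbs R.BN hB, ∃ h : S.HA R.AN hA,
        ModelFrobenioid.baseMap R.pair.num ≫ g.hom =
          (S.autBase R.AN (h : Aut R.AN)).hom ≫ ModelFrobenioid.baseMap R.pair.num) :
    S.Prop43_i pullFrac :=
  S.prop43_i_of' pullFrac S.tf.isDivisorial_divisorMonoid hα hamp

end Literature.AnabelianGeometry.EtaleTheta

end
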